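import Literature.Topology.FourManifolds.GenericMapCuspsFinite
import Literature.Topology.FourManifolds.FoldChartSigCritical
import HarnessLib

/-!
# The fold locus is a smoothly immersed arc near every fold point

Topic `Literature/Topology/FourManifolds` (programme of the fact
`Literature.Topology.FourManifolds.exists_isSimplifiedBrokenLefschetzFibration`, Baykur–Saeki 2017, §2.1
p. 6: *"the set of fold points is a smooth 1-dimensional submanifold and `f` restricted to it
is an immersion"*).  From a fold point with charts (`HasManifoldFoldChart g p`:
`ψ ∘ g = (φ₀, s₁φ₁² + s₂φ₂² + s₃φ₃²)`, `sᵢ = ±1`) we extract the arc `γ(t) = φ⁻¹(t e₀)`: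
it is `C^∞` and injective on an interval `(-δ, δ)`, `γ(0) = p`, its points are critical points
of `g`, every critical point of `g` near `p` lies on it, and `g ∘ γ` is an immersion
(`g (γ t) = ψ⁻¹(t e₀)`).

* `HasManifoldFoldChart.exists_arc`.

Everything is proved; no definitions, no named facts (D-0026).

## References

* R. İ. Baykur, O. Saeki, *Simplifying indefinite fibrations on 4-manifolds*, arXiv:1705.11169,
  §2.1, p. 6. [BaykurSaeki2017]
* M. Golubitsky, V. Guillemin, *Stable Mappings and Their Singularities*, GTM 14 (1973), Ch. III
  §4, Thm. 4.5 (fold locus a submanifold, `f` restricted to it an immersion). [GolubitskyGuillemin1973]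
-/

noncomputable section

set_option maxSynthPendingDepth 2

open Set Function Filter Module
open scoped ContDiff Topology Manifold

namespace Literature.Topology.FourManifolds

/-- Local notation for this file: the model space `ℝⁿ = EuclideanSpace ℝ (Fin n)`. -/
local notation "𝔼 " n:arg => EuclideanSpace ℝ (Fin n)

variable {X : Type*} [TopologicalSpace X] [ChartedSpace (𝔼 4) X]
  {B : Type*} [TopologicalSpace B] [ChartedSpace (𝔼 2) B]

/-- The fold model on the `t`-axis: `F(t e₀) = t e₀`. [folklore] -/
theorem foldSigMap_smul_single (s₁ s₂ s₃ t : ℝ) :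
    foldSigMap s₁ s₂ s₃ (t • EuclideanSpace.single (0 : Fin 4) (1 : ℝ)) =
      t • EuclideanSpace.single (0 : Fin 2) (1 : ℝ) := by
  ext i
  fin_cases i <;> simp

/-- **The fold locus is a smoothly immersed arc near a fold point with charts.**  If `g : X → B`
has a fold chart at `p`, there are `δ > 0` and `γ : ℝ → X`, `C^∞` and injective on `(-δ, δ)`,
with `γ 0 = p`, every `γ t` a critical point of `g`, every critical point of `g` near `p` of
the form `γ t`, and `g ∘ γ` an immersion on `(-δ, δ)`.
[cite: BaykurSaeki2017, §2.1, p. 6] [cite: GolubitskyGuillemin1973, Ch. III §4, Thm. 4.5] -/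
theorem HasManifoldFoldChart.exists_arc {g : X → B} {p : X} (h : HasManifoldFoldChart g p) :
    ∃ (δ : ℝ) (γ : ℝ → X), 0 < δ ∧ γ 0 = p ∧
      ContMDiffOn 𝓘(ℝ, ℝ) (𝓡 4) ∞ γ (Ioo (-δ) δ) ∧ InjOn γ (Ioo (-δ) δ) ∧
      (∀ t ∈ Ioo (-δ) δ, ¬ Surjective (mfderiv (𝓡 4) (𝓡 2) g (γ t))) ∧
      (∃ U ∈ 𝓝 p, ∀ q ∈ U, ¬ Surjective (mfderiv (𝓡 4) (𝓡 2) g q) → q ∈ γ '' Ioo (-δ) δ) ∧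
      ∀ t ∈ Ioo (-δ) δ, Injective (mfderiv 𝓘(ℝ, ℝ) (𝓡 2) (g ∘ γ) t) := by
  obtain ⟨s₁, s₂, s₃, φ, ψ, hs₁, hs₂, hs₃, hp, hp0, hmaps, hφ, hφs, hψ, hψs, hid⟩ := h
  have hs₁0 : s₁ ≠ 0 := by rintro rfl; norm_num at hs₁
  have hs₂0 : s₂ ≠ 0 := by rintro rfl; norm_num at hs₂
  have hs₃0 : s₃ ≠ 0 := by rintro rfl; norm_num at hs₃
  set e₀ : 𝔼 4 := EuclideanSpace.single (0 : Fin 4) (1 : ℝ) with he₀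
  set e₀' : 𝔼 2 := EuclideanSpace.single (0 : Fin 2) (1 : ℝ) with he₀'
  -- a ball in the chart target
  have h0t : (0 : 𝔼 4) ∈ φ.target := hp0 ▸ φ.map_source hp
  obtain ⟨δ, hδ, hball⟩ := Metric.isOpen_iff.1 φ.open_target 0 h0t
  have he₀n : ‖e₀‖ = 1 := by simp [he₀]
  have hline : ∀ t ∈ Ioo (-δ) δ, t • e₀ ∈ φ.target := by
    intro t ht
    apply hball
    rw [Metric.mem_ball, dist_zero_right, norm_smul, he₀n, mul_one, Real.norm_eq_abs, abs_lt]
    exact ht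
  set γ : ℝ → X := fun t => φ.symm (t • e₀) with hγ
  have hγsrc : ∀ t ∈ Ioo (-δ) δ, γ t ∈ φ.source := fun t ht => φ.map_target (hline t ht)
  have hφγ : ∀ t ∈ Ioo (-δ) δ, φ (γ t) = t • e₀ := fun t ht => φ.right_inv (hline t ht)
  -- smoothness of the line and of `γ`
  have hlc : ContDiff ℝ ∞ fun t : ℝ => t • e₀ := contDiff_id.smul contDiff_const
  have hγs : ContMDiffOn 𝓘(ℝ, ℝ) (𝓡 4) ∞ γ (Ioo (-δ) δ) :=
    hφs.comp hlc.contMDiff.contMDiffOn fun t ht => hline t ht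
  -- critical points on the arc and near `p`
  have hcritγ : ∀ t ∈ Ioo (-δ) δ, ¬ Surjective (mfderiv (𝓡 4) (𝓡 2) g (γ t)) := by
    intro t ht
    rw [surjective_mfderiv_iff_of_foldChartSig hmaps hφ hφs hψ hψs hid hs₁0 hs₂0 hs₃0
      (hγsrc t ht), not_not, hφγ t ht]
    simp [he₀]
  refine ⟨δ, γ, hδ, ?_, hγs, ?_, hcritγ, ?_, ?_⟩
  · show φ.symm ((0 : ℝ) • e₀) = p
    rw [zero_smul, ← hp0, φ.left_inv hp]
  · intro t ht t' ht' htt'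
    have h1 : t • e₀ = t' • e₀ := by rw [← hφγ t ht, ← hφγ t' ht', htt']
    have h2 := congrArg (fun v : 𝔼 4 => v 0) h1
    simpa [he₀] using h2
  · refine ⟨φ.source ∩ φ ⁻¹' Metric.ball 0 δ, ?_, ?_⟩
    · refine (φ.continuousOn.isOpen_inter_preimage φ.open_source Metric.isOpen_ball).mem_nhds
        ⟨hp, ?_⟩
      rw [mem_preimage, hp0]
      exact Metric.mem_ball_self hδ
    · rintro q ⟨hq, hqb⟩ hcrit
      rw [surjective_mfderiv_iff_of_foldChartSig hmaps hφ hφs hψ hψs hid hs₁0 hs₂0 hs₃0 hq,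
        not_not] at hcrit
      obtain ⟨h1, h2, h3⟩ := hcrit
      have hφq : φ q = (φ q 0) • e₀ := by
        ext i
        fin_cases i
        · simp [he₀]
        · simpa [he₀] using h1
        · simpa [he₀] using h2
        · simpa [he₀] using h3
      have hnorm : ‖φ q‖ = |φ q 0| := by
        rw [hφq, norm_smul, he₀n, mul_one, Real.norm_eq_abs]
        simp [he₀]
      have ht : φ q 0 ∈ Ioo (-δ) δ := by
        rw [mem_preimage, Metric.mem_ball, dist_zero_right, hnorm, abs_lt] at hqb
        exact hqb
      refine ⟨φ q 0, ht, ?_⟩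
      show φ.symm ((φ q 0) • e₀) = q
      rw [← hφq, φ.left_inv hq]
  · -- `g ∘ γ = ψ⁻¹ ∘ (t ↦ t e₀')` on the interval, an immersion
    intro t ht
    have hψmd : ψ.MDifferentiable (𝓡 2) (𝓡 2) :=
      ⟨hψ.mdifferentiableOn (by simp), hψs.mdifferentiableOn (by simp)⟩
    have hval : ∀ t' ∈ Ioo (-δ) δ, ψ (g (γ t')) = t' • e₀' := by
      intro t' ht'
      rw [apply_eq_foldSigMap_of_foldChart hid (hγsrc t' ht'), hφγ t' ht', foldSigMap_smul_single]
    have hev : (g ∘ γ) =ᶠ[𝓝 t] (ψ.symm ∘ fun t' : ℝ => t' • e₀') := by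
      filter_upwards [isOpen_Ioo.mem_nhds ht] with t' ht'
      show g (γ t') = ψ.symm (t' • e₀')
      rw [← hval t' ht', ψ.left_inv (hmaps (hγsrc t' ht'))]
    have hyt : t • e₀' ∈ ψ.target := by
      rw [← hval t ht]
      exact ψ.map_source (hmaps (hγsrc t ht))
    set L : ℝ →L[ℝ] 𝔼 2 := (1 : ℝ →L[ℝ] ℝ).smulRight e₀' with hL
    have hc : HasMFDerivAt 𝓘(ℝ, ℝ) (𝓡 2) (fun t' : ℝ => t' • e₀') t L :=
      (((1 : ℝ →L[ℝ] ℝ).hasFDerivAt).smul_const e₀' |>.congr_fderiv (by ext; simp [hL])).hasMFDerivAt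
    have hψq : HasMFDerivAt (𝓡 2) (𝓡 2) ψ.symm (t • e₀')
        (mfderiv (𝓡 2) (𝓡 2) ψ.symm (t • e₀')) :=
      (hψmd.mdifferentiableAt_symm hyt).hasMFDerivAt
    have hcomp := hψq.comp t hc
    have hgγ : HasMFDerivAt 𝓘(ℝ, ℝ) (𝓡 2) (g ∘ γ) t
        ((mfderiv (𝓡 2) (𝓡 2) ψ.symm (t • e₀')).comp L) := hcomp.congr_of_eventuallyEq hev
    rw [hgγ.mfderiv]
    have hA := hψmd.symm.mfderiv_bijective hyt
    have hLi : Injective L := by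
      intro a b hab
      have h1 : a • e₀' = b • e₀' := by simpa [hL] using hab
      have h2 := congrArg (fun v : 𝔼 2 => v 0) h1
      simpa [he₀'] using h2
    have h : Injective (⇑(mfderiv (𝓡 2) (𝓡 2) ψ.symm (t • e₀')) ∘ ⇑L) := hA.1.comp hLi
    exact h

end Literature.Topology.FourManifolds
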